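import Summits.Ventures.WeilGRH.TwistedSechTableDiag
import HarnessLib

/-!
# GRH arm (rh-explicit, venture WeilGRH): kernel checkers of literal `sech` tables

Cell `rh-explicit`, WEIL TRACK — GRH ARM (engine seat weil-grh-2 gen8).  A literal sine table `stab` (boxes of
`I_n = ∫_{(0,2a]} σ(t) sin(πn t/a) dt`, `n < N`) and a literal diagonal table `dtab` (boxes of `sechIncrCoeff a n n`,
`n < B`) are validated by re-computation in the kernel against `SechEncl.sinBox` / `SechEncl.diagBox`
(`TwistedSechTable.lean`, `TwistedSechTableDiag.lean`): `checkSinTab` / `checkDiagTab` with the soundness theorems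
`sinTabValid_of_check` / `diagTabValid_of_check`.  Consumed by `TwistedGramCellCheckH.lean`.
Everything is PROVED; computable `def`s with docstrings; no named facts; RH/GRH-free; standard axioms.
References: R. E. Moore (1966) Ch. 3 [Moore1966].
-/

set_option autoImplicit false

open Real MeasureTheory Set
open scoped BigOperators

namespace Summit.Ventures.WeilGRH

open Literature.Analysis.ValidatedNumerics.NumericsMP

namespace TwistedEncl

variable {S : ℕ} {a : ℝ}

/-! ## Literal `sech` tables and their kernel checkers -/

/-! Table validity is stated inline below: a SINE table `stab` is valid below `N` when
`∀ n < N, stab[n] ∋ I_n = ∫_{(0,2a]} σ(t) sin(πn t/a) dt`; a DIAGONAL table `dtab` is valid below `B` when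
`∀ n < B, dtab[n] ∋ sechIncrCoeff a n n`. -/

/-- Kernel checker of a literal sine table against `SechEncl.sinBox` (exact equality of boxes).
[cite: Moore1966, Ch. 3 (interval arithmetic: inclusion property)] -/
def checkSinTab (S : ℕ) (P A E0 R : MI) (K N : ℕ) (stab : List MI) : Bool :=
  (List.range N).all fun n ↦
    match SechEncl.omegaBox S P A n with
    | some Ω => decide (SechEncl.sinBox S Ω E0 R K = some (stab.getD n default))
    | none => false

/-- `checkSinTab = true` ⇒ the sine table is valid below `N`. [cite: Moore1966, Ch. 3 (interval arithmetic: inclusion property)] -/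
theorem sinTabValid_of_check (hS : 0 < S) (ha : 0 < a) {P A E0 R : MI} (hP : MI.mem S Real.pi P) (hA : MI.mem S a A)
    (hE0 : MI.mem S (Real.exp (-a)) E0) (hR : MI.mem S (Real.exp (-(2 * a))) R) {K N : ℕ} {stab : List MI}
    (h : checkSinTab S P A E0 R K N stab = true) :
    ∀ n : ℕ, n < N → MI.mem S (∫ t in Ioc 0 (2 * a), 1 / (2 * Real.cosh (t / 2)) * Real.sin (π * n / a * t)) (stab.getD n default) := by
  intro n hn
  unfold checkSinTab at h
  simp only [List.all_eq_true, List.mem_range] at h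
  have hn' := h n hn
  split at hn'
  · rename_i Ω hΩ
    simp only [decide_eq_true_eq] at hn'
    exact SechEncl.mem_sinBox hS ha hP hA hΩ hE0 hR hn'
  · simp at hn'

/-- Kernel checker of a literal diagonal table against `SechEncl.diagBox`. [cite: Moore1966, Ch. 3 (interval arithmetic: inclusion property)] -/
def checkDiagTab (S Karc : ℕ) (P A EA E0 R : MI) (K B : ℕ) (dtab : List MI) : Bool :=
  (List.range B).all fun n ↦
    match SechEncl.omegaBox S P A n with
    | some Ω => decide (SechEncl.diagBox S Karc P A EA Ω E0 R K = some (dtab.getD n default))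
    | none => false

/-- `checkDiagTab = true` ⇒ the diagonal table is valid below `B`. [cite: Moore1966, Ch. 3 (interval arithmetic: inclusion property)] -/
theorem diagTabValid_of_check (hS : 0 < S) (ha : 0 < a) {Karc : ℕ} {P A EA E0 R : MI} (hP : MI.mem S Real.pi P)
    (hA : MI.mem S a A) (hEA : MI.mem S (Real.exp a) EA) (hE0 : MI.mem S (Real.exp (-a)) E0)
    (hR : MI.mem S (Real.exp (-(2 * a))) R) {K B : ℕ} {dtab : List MI}
    (h : checkDiagTab S Karc P A EA E0 R K B dtab = true) :
    ∀ n : ℕ, n < B → MI.mem S (sechIncrCoeff a n n) (dtab.getD n default) := by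
  intro n hn
  unfold checkDiagTab at h
  simp only [List.all_eq_true, List.mem_range] at h
  have hn' := h n hn
  split at hn'
  · rename_i Ω hΩ
    simp only [decide_eq_true_eq] at hn'
    exact SechEncl.mem_diagBox hS ha hP hA hEA hΩ hE0 hR hn'
  · simp at hn'

end TwistedEncl

end Summit.Ventures.WeilGRH
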